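import Literature.Computation.Certificates.PosSemidef
import Literature.Computation.Certificates.Data

/-!
# Self-certifying PSD / PD / not-PSD tests for rational matrices (the exact `LDLᵀ` runs in the kernel)

Compute-infrastructure file (unit `infra-psd-sos-lp-checker`, gen 2). `PosSemidef.lean` CHECKS a
Gram certificate `(d, B)` that the user supplies; this file COMPUTES the certificate inside the
kernel by exact symmetric Gaussian elimination (`LDLᵀ` without pivoting, rational arithmetic), so
that for a LITERAL rational matrix `A : Matrix (Fin n) (Fin n) ℚ` each of

* `(A.map (Rat.cast : ℚ → ℝ)).PosSemidef`   — `PSD.LDLCert.posSemidef (by decide +kernel)`,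
* `(A.map (Rat.cast : ℚ → ℝ)).PosDef`       — `PSD.LDLCertPD.posDef (by decide +kernel)`
  (the margin `ε` with `A − ε·1 ⪰ 0` is SEARCHED in the kernel by halving from `ε₀`),
* `¬ (A.map (Rat.cast : ℚ → ℝ)).PosSemidef` — `PSD.NegCert.not_posSemidef (by decide +kernel)`
  (a rational vector with negative quadratic form is FOUND in the kernel),
* `¬ (A.map (Rat.cast : ℚ → ℝ)).PosDef`     — `PSD.NonposCert.not_posDef (by decide +kernel)`,

is closed by ONE `decide +kernel`, with no external tool and no certificate literal in the file.
Soundness costs nothing new: the generated data are fed to the TRUSTED predicates `PSD.IsGramCert` /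
`PSD.IsGramCertPD` of `PosSemidef.lean` (resp. to the one-line refutation predicates
`PSD.IsNegWitness` / `PSD.IsNonposWitness` below), whose soundness theorems are already proved; the
generators (`ldlRows`, `pdMargin`, `negWitnessRows`, `nonposWitnessRows`) are untrusted programs —
if they produced garbage the kernel check would simply fail. (They are, in fact, complete for
symmetric input: for symmetric rational `A` exactly one of `LDLCert A` / `NegCert A` holds, by the
Schur-complement characterisation `[[a, bᵀ], [b, C]] ⪰ 0 ⇔ (a > 0 ∧ C − bbᵀ/a ⪰ 0) ∨ (a = 0 ∧ b = 0 ∧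
C ⪰ 0)`; this completeness is exercised by the tests below but deliberately not proved — nothing
depends on it.)

## API (namespace `Literature.Computation.Certificates.PSD`)

* generators on row lists (structural recursion, kernel-evaluable): `rowsOf`, `schurRows`,
  `ldlRows` (pivots + unit upper-triangular factor rows), `ldlFactor A` (the same as
  `(Fin n → ℚ) × Matrix (Fin n) (Fin n) ℚ`), `pivotsPos`, `pdMargin A K ε₀` (first `ε₀ / 2ᵏ`,
  `k ≤ K`, at which all pivots of `A − ε·1` are positive), `negWitnessRows` / `negWitness A`,
  `nonposWitnessRows` / `nonposWitness A`;
* trusted predicates (decidable) and their soundness: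
  `LDLCert A` (`:= IsGramCert A (ldlFactor A).1 (ldlFactor A).2`) with `.quadForm_nonneg/'`,
  `.dotProduct_mulVec_nonneg`, `.posSemidef`, `.posSemidef_rat`;
  `LDLCertPD A K ε₀` with `.margin_pos`, `.quadForm_ge` (`pdMargin A K ε₀ · ∑ xᵢ² ≤ xᵀAx`, a certified
  rational lower bound on `λ_min`), `.quadForm_pos`, `.posDef`, `.posDef_rat`;
  `IsNegWitness A x` (`xᵀAx < 0`) with `.not_posSemidef`, `.not_posDef`; `NegCert A`
  (`:= IsNegWitness A (negWitness A)`) likewise; `IsNonposWitness A x` (`x ≠ 0 ∧ xᵀAx ≤ 0`) with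
  `.not_posDef`; `NonposCert A` likewise; `not_posSemidef_of_not_symm`, `not_posDef_of_not_symm`
  (the non-symmetric case, also by `decide`).
* Kernel-checked tests at the end (usage templates), including the `8 × 8` Hilbert matrix
  (positive definite with `λ_min ≈ 1.1 · 10⁻¹⁰`: the halving search certifies the margin `2⁻³⁴`).

## Cost (kernel, `decide +kernel`, measured 2026-08-17 on the farm; see the README §3 for the memory cap)

One elimination is `n³/3` exact rational operations on the entries of the successive Schur
complements (ratios of minors of `A`, so digit counts stay proportional to those of an exact
`LDLᵀ` certificate); the Gram re-check is the `O(n³)` of `IsGramCert`. For dense integer Gram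
matrices `A = MᵀM` (`M` random with entries in `[-5, 5]`, given as `!![…]` literals) `LDLCert`
takes ≈ 3 s at `n = 15`, 8 s at `20`, 16 s at `25`, 28 s at `30`, 70 s at `40` — the same as
CHECKING a supplied exact certificate with `IsGramCert` — and `n = 50` exceeds the kernel memory cap
(symptom: "failed to reduce to isTrue/isFalse"); beyond `n ≈ 45` print the certificate with
`#eval PSD.ldlRows n (PSD.rowsOf A)` and check it block-wise (`IsGramCert.intro` +
`forall_fin_of_blocks`, `Blocks.lean`), round it for `IsGramCertDD`, or use `native_decide` under the
`--computational` regime. The PD search runs at most `K + 1` eliminations, each aborted at the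
first nonpositive pivot (`n = 20`, `K = 60`: 19 s in all); refutations stop at the first bad pivot
(`n = 20`: < 1 s).

## References

G. Blekherman, P. Parrilo, R. Thomas (eds.), *Semidefinite Optimization and Convex Algebraic
Geometry*, SIAM 2012, App. A.1.2 (rational `LDLᵀ`; Schur complements and semidefiniteness)
[cite: BlekhermanParriloThomas2012, App. A.1.2]; N. J. Higham, *Accuracy and Stability of Numerical
Algorithms*, 2nd ed., SIAM 2002, Ch. 10 (symmetric elimination / Cholesky without pivoting for
(semi)definite matrices) [folklore].
-/

namespace Literature.Computation.Certificates

namespace PSD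

open Finset Matrix

variable {n : ℕ}
variable {R : Type*} [Field R] [LinearOrder R] [IsStrictOrderedRing R]

/-! ### Generators: exact symmetric elimination on row lists (untrusted, kernel-evaluable) -/

/-- The rows of a `Fin`-indexed rational matrix as a list of lists. [folklore] -/
def rowsOf (A : Matrix (Fin n) (Fin n) ℚ) : List (List ℚ) :=
  List.ofFn fun i => List.ofFn fun j => A i j

/-- One Schur-complement step on a symmetric block given by rows: first row `a :: bT` with pivot
`a ≠ 0`, remaining rows `rest = [bᵢ :: Cᵢ]`; returns the rows of `C − b bᵀ / a` (the column `b` is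
read off the row `bT`, i.e. symmetry of the input is assumed — an asymmetric input only makes the
final trusted check fail). [cite: BlekhermanParriloThomas2012, App. A.1.2] -/
def schurRows (a : ℚ) (bT : List ℚ) (rest : List (List ℚ)) : List (List ℚ) :=
  List.zipWith (fun (r : List ℚ) (bi : ℚ) => List.zipWith (fun cij bj => cij - bi / a * bj) r.tail bT)
    rest bT

/-- **Exact `LDLᵀ` without pivoting on row lists** (first argument = fuel ≥ number of rows).
Returns the pivots `[d₀, d₁, …]` and the rows of a unit upper-triangular `B` such that, for a
positive semidefinite input `A`, `A = Bᵀ · diag d · B` exactly. A nonpositive pivot is recorded as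
`0` with factor row `eₖ` and its row/column is dropped (for PSD input a zero pivot forces a zero
row, so nothing is lost; otherwise the output is harmless garbage rejected by the trusted check).
[cite: BlekhermanParriloThomas2012, App. A.1.2] -/
def ldlRows : ℕ → List (List ℚ) → List ℚ × List (List ℚ)
  | 0, _ => ([], [])
  | _ + 1, [] => ([], [])
  | k + 1, row :: rest =>
    let a := row.headD 0
    let bT := row.tail
    if 0 < a then
      let p := ldlRows k (schurRows a bT rest)
      (a :: p.1, (1 :: bT.map (· / a)) :: p.2.map (List.cons 0))
    else
      let p := ldlRows k (rest.map List.tail)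
      (0 :: p.1, (1 :: bT.map fun _ => 0) :: p.2.map (List.cons 0))

/-- The in-kernel Gram certificate of `A`: pivots as a `Fin n`-vector, factor as an `n × n` matrix
(through the list-backed carriers of `Data.lean`). [folklore] -/
def ldlFactor (A : Matrix (Fin n) (Fin n) ℚ) : (Fin n → ℚ) × Matrix (Fin n) (Fin n) ℚ :=
  (vecOfList n (ldlRows n (rowsOf A)).1, matrixOfRows n n (ldlRows n (rowsOf A)).2)

/-- Quick test "all pivots of the exact elimination are positive", aborting at the first
nonpositive pivot (used by the margin search; untrusted). [folklore] -/
def pivotsPos : ℕ → List (List ℚ) → Bool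
  | 0, _ => true
  | _ + 1, [] => true
  | k + 1, row :: rest =>
    let a := row.headD 0
    decide (0 < a) && pivotsPos k (schurRows a row.tail rest)

/-- **Margin search**: `pdMargin A K ε₀` is the first `ε = ε₀ / 2ᵏ`, `k ≤ K`, such that all pivots
of `A − ε · 1` are positive (and `ε₀ / 2ᴷ` if none is; the trusted check then fails unless that
last value happens to work). Untrusted. [folklore] -/
def pdMargin (A : Matrix (Fin n) (Fin n) ℚ) : ℕ → ℚ → ℚ
  | 0, ε => ε
  | K + 1, ε =>
    if pivotsPos n (rowsOf (A - ε • (1 : Matrix (Fin n) (Fin n) ℚ))) then ε else pdMargin A K (ε / 2)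

/-- Index and value of the first nonzero entry of a list (indices counted from the second
argument). [folklore] -/
def firstNonzero : List ℚ → ℕ → Option (ℕ × ℚ)
  | [], _ => none
  | x :: l, i => if x = 0 then firstNonzero l (i + 1) else some (i, x)

/-- The list of length `len` with value `v` at position `j` and `0` elsewhere. [folklore] -/
def spike (len j : ℕ) (v : ℚ) : List ℚ :=
  (List.range len).map fun i => if i = j then v else 0

/-- **Search for a vector with negative quadratic form** (untrusted): run the elimination; at a
negative pivot return `eₖ`, at a zero pivot with a nonzero off-diagonal entry `bⱼ` return
`t·eₖ + eⱼ` with `2 t bⱼ + Cⱼⱼ = −1`, and back-substitute through the unit upper-triangular factor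
of the eliminated part (so that its squares vanish). For symmetric input this succeeds exactly when
the matrix is not positive semidefinite. [cite: BlekhermanParriloThomas2012, App. A.1.2] -/
def negWitnessRows : ℕ → List (List ℚ) → Option (List ℚ)
  | 0, _ => none
  | _ + 1, [] => none
  | k + 1, row :: rest =>
    let a := row.headD 0
    let bT := row.tail
    if 0 < a then
      (negWitnessRows k (schurRows a bT rest)).map fun w =>
        (-(List.zipWith (· * ·) bT w).sum / a) :: w
    else if a < 0 then
      some (1 :: bT.map fun _ => 0)
    else
      match firstNonzero bT 0 with
      | some (j, bj) =>
        let cjj := (rest.getD j []).getD (j + 1) 0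
        some ((-1 - cjj) / (2 * bj) :: spike bT.length j 1)
      | none => (negWitnessRows k (rest.map List.tail)).map (List.cons 0)

/-- The in-kernel refutation vector of `A` (zero vector if the search fails). [folklore] -/
def negWitness (A : Matrix (Fin n) (Fin n) ℚ) : Fin n → ℚ :=
  vecOfList n ((negWitnessRows n (rowsOf A)).getD [])

/-- **Search for a NONZERO vector with nonpositive quadratic form** (untrusted; refutes positive
definiteness): `eₖ` at the first nonpositive pivot, back-substituted as in `negWitnessRows`.
[cite: BlekhermanParriloThomas2012, App. A.1.2] -/
def nonposWitnessRows : ℕ → List (List ℚ) → Option (List ℚ)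
  | 0, _ => none
  | _ + 1, [] => none
  | k + 1, row :: rest =>
    let a := row.headD 0
    let bT := row.tail
    if 0 < a then
      (nonposWitnessRows k (schurRows a bT rest)).map fun w =>
        (-(List.zipWith (· * ·) bT w).sum / a) :: w
    else
      some (1 :: bT.map fun _ => 0)

/-- The in-kernel `PosDef`-refutation vector of `A` (zero vector if the search fails). [folklore] -/
def nonposWitness (A : Matrix (Fin n) (Fin n) ℚ) : Fin n → ℚ :=
  vecOfList n ((nonposWitnessRows n (rowsOf A)).getD [])

/-! ### Positive semidefiniteness: `LDLCert` -/

/-- **Self-certificate of positive semidefiniteness**: the Gram certificate computed in the kernel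
by `ldlFactor` is valid for `A` (trusted predicate = `IsGramCert`). Decidable; close it by
`decide +kernel`. [cite: BlekhermanParriloThomas2012, App. A.1.2] -/
def LDLCert (A : Matrix (Fin n) (Fin n) ℚ) : Prop :=
  IsGramCert A (ldlFactor A).1 (ldlFactor A).2

/-- Decidability of `LDLCert`. [folklore] -/
instance LDLCert.instDecidable (A : Matrix (Fin n) (Fin n) ℚ) : Decidable (LDLCert A) :=
  inferInstanceAs (Decidable (IsGramCert A (ldlFactor A).1 (ldlFactor A).2))

namespace LDLCert

variable {A : Matrix (Fin n) (Fin n) ℚ}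

/-- The underlying Gram certificate. [folklore] -/
theorem isGramCert (h : LDLCert A) : IsGramCert A (ldlFactor A).1 (ldlFactor A).2 := h

/-- `A` is symmetric. [folklore] -/
theorem isSymm (h : LDLCert A) : A.IsSymm := h.isGramCert.isSymm

/-- **Soundness (quadratic form)**: `0 ≤ ∑ i, ∑ j, x i * A i j * x j` over any linearly ordered
field. [cite: BlekhermanParriloThomas2012, App. A.1.2] -/
theorem quadForm_nonneg (h : LDLCert A) (x : Fin n → R) :
    0 ≤ ∑ i, ∑ j, x i * (A i j : R) * x j :=
  h.isGramCert.quadForm_nonneg x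

/-- The `x i * x j * A i j` arrangement (positive-type / Bochner shape). [folklore] -/
theorem quadForm_nonneg' (h : LDLCert A) (x : Fin n → R) :
    0 ≤ ∑ i, ∑ j, x i * x j * (A i j : R) :=
  h.isGramCert.quadForm_nonneg' x

/-- `0 ≤ x ⬝ᵥ (A.map cast *ᵥ x)`. [folklore] -/
theorem dotProduct_mulVec_nonneg (h : LDLCert A) (x : Fin n → R) :
    0 ≤ x ⬝ᵥ (A.map (Rat.cast : ℚ → R) *ᵥ x) :=
  h.isGramCert.dotProduct_mulVec_nonneg x

/-- **Soundness (`Matrix.PosSemidef`)** over any linearly ordered field with trivial star, e.g.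
`ℝ`: `(A.map (Rat.cast : ℚ → R)).PosSemidef`. [cite: BlekhermanParriloThomas2012, App. A.1.2] -/
theorem posSemidef [StarRing R] [TrivialStar R] (h : LDLCert A) :
    (A.map (Rat.cast : ℚ → R)).PosSemidef :=
  h.isGramCert.posSemidef

/-- Soundness over `ℚ` itself. [folklore] -/
theorem posSemidef_rat (h : LDLCert A) : A.PosSemidef := h.isGramCert.posSemidef_rat

end LDLCert

/-! ### Positive definiteness with a searched margin: `LDLCertPD` -/

/-- **Self-certificate of positive definiteness**: with `ε := pdMargin A K ε₀` (searched in the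
kernel), the Gram certificate of `A − ε · 1` computed in the kernel is valid and `0 < ε` (trusted
predicate = `IsGramCertPD`). `K = 0` means: use exactly `ε₀`. Decidable; close it by
`decide +kernel`. [cite: BlekhermanParriloThomas2012, App. A.1.2] -/
def LDLCertPD (A : Matrix (Fin n) (Fin n) ℚ) (K : ℕ) (ε₀ : ℚ) : Prop :=
  IsGramCertPD A (pdMargin A K ε₀)
    (ldlFactor (A - pdMargin A K ε₀ • (1 : Matrix (Fin n) (Fin n) ℚ))).1
    (ldlFactor (A - pdMargin A K ε₀ • (1 : Matrix (Fin n) (Fin n) ℚ))).2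

/-- Decidability of `LDLCertPD`. [folklore] -/
instance LDLCertPD.instDecidable (A : Matrix (Fin n) (Fin n) ℚ) (K : ℕ) (ε₀ : ℚ) :
    Decidable (LDLCertPD A K ε₀) :=
  inferInstanceAs (Decidable (IsGramCertPD A (pdMargin A K ε₀)
    (ldlFactor (A - pdMargin A K ε₀ • (1 : Matrix (Fin n) (Fin n) ℚ))).1
    (ldlFactor (A - pdMargin A K ε₀ • (1 : Matrix (Fin n) (Fin n) ℚ))).2))

namespace LDLCertPD

variable {A : Matrix (Fin n) (Fin n) ℚ} {K : ℕ} {ε₀ : ℚ}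

/-- The underlying margin certificate. [folklore] -/
theorem isGramCertPD (h : LDLCertPD A K ε₀) :
    IsGramCertPD A (pdMargin A K ε₀)
      (ldlFactor (A - pdMargin A K ε₀ • (1 : Matrix (Fin n) (Fin n) ℚ))).1
      (ldlFactor (A - pdMargin A K ε₀ • (1 : Matrix (Fin n) (Fin n) ℚ))).2 := h

/-- The searched margin is positive. [folklore] -/
theorem margin_pos (h : LDLCertPD A K ε₀) : 0 < pdMargin A K ε₀ := h.isGramCertPD.1

/-- `A` is symmetric. [folklore] -/
theorem isSymm (h : LDLCertPD A K ε₀) : A.IsSymm := h.isGramCertPD.isSymm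

/-- **Certified eigenvalue margin**: `pdMargin A K ε₀ · ∑ xᵢ² ≤ xᵀ A x` (a rational lower bound on
`λ_min (A)`, found and certified in the kernel). [cite: BlekhermanParriloThomas2012, App. A.1.2] -/
theorem quadForm_ge (h : LDLCertPD A K ε₀) (x : Fin n → R) :
    (pdMargin A K ε₀ : R) * ∑ i, x i ^ 2 ≤ ∑ i, ∑ j, x i * (A i j : R) * x j :=
  h.isGramCertPD.quadForm_ge x

/-- `xᵀ A x > 0` for `x ≠ 0`. [folklore] -/
theorem quadForm_pos (h : LDLCertPD A K ε₀) {x : Fin n → R} (hx : x ≠ 0) :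
    0 < ∑ i, ∑ j, x i * (A i j : R) * x j :=
  h.isGramCertPD.quadForm_pos hx

/-- **Soundness (`Matrix.PosDef`)** over any linearly ordered field with trivial star, e.g. `ℝ`.
[cite: BlekhermanParriloThomas2012, App. A.1.2] -/
theorem posDef [StarRing R] [TrivialStar R] (h : LDLCertPD A K ε₀) :
    (A.map (Rat.cast : ℚ → R)).PosDef :=
  h.isGramCertPD.posDef

/-- Soundness over `ℚ` itself. [folklore] -/
theorem posDef_rat (h : LDLCertPD A K ε₀) : A.PosDef := h.isGramCertPD.posDef_rat

/-- Positive definite implies positive semidefinite (convenience). [folklore] -/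
theorem posSemidef [StarRing R] [TrivialStar R] (h : LDLCertPD A K ε₀) :
    (A.map (Rat.cast : ℚ → R)).PosSemidef :=
  h.posDef.posSemidef

end LDLCertPD

/-! ### Refutations: negative / nonpositive quadratic-form witnesses -/

/-- The rational quadratic form, cast: `((xᵀAx : ℚ) : R) = ∑ i, (x i : R) * ∑ j, A i j * x j`
(the `dotProduct`/`mulVec` arrangement). [folklore] -/
theorem cast_quadForm (A : Matrix (Fin n) (Fin n) ℚ) (x : Fin n → ℚ) :
    ((∑ i, ∑ j, x i * A i j * x j : ℚ) : R) =
      (fun i => (x i : R)) ⬝ᵥ (A.map (Rat.cast : ℚ → R) *ᵥ fun i => (x i : R)) := by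
  simp only [dotProduct, Matrix.mulVec, Matrix.map_apply, Finset.mul_sum, Rat.cast_sum,
    Rat.cast_mul]
  exact Finset.sum_congr rfl fun i _ => Finset.sum_congr rfl fun j _ => by ring

/-- **Witness of non-semidefiniteness**: a rational vector with `xᵀ A x < 0`. Decidable.
[folklore] -/
def IsNegWitness (A : Matrix (Fin n) (Fin n) ℚ) (x : Fin n → ℚ) : Prop :=
  ∑ i, ∑ j, x i * A i j * x j < 0

/-- Decidability of `IsNegWitness`. [folklore] -/
instance IsNegWitness.instDecidable (A : Matrix (Fin n) (Fin n) ℚ) (x : Fin n → ℚ) :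
    Decidable (IsNegWitness A x) :=
  inferInstanceAs (Decidable (∑ i, ∑ j, x i * A i j * x j < 0))

namespace IsNegWitness

variable {A : Matrix (Fin n) (Fin n) ℚ} {x : Fin n → ℚ}

/-- **Soundness**: a negative witness refutes `PosSemidef` of the cast matrix over any linearly
ordered field with trivial star (e.g. `ℝ`). [folklore] -/
theorem not_posSemidef [StarRing R] [TrivialStar R] (h : IsNegWitness A x) :
    ¬ (A.map (Rat.cast : ℚ → R)).PosSemidef := by
  intro hA
  have h1 := hA.dotProduct_mulVec_nonneg fun i => (x i : R)
  rw [star_trivial, ← cast_quadForm] at h1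
  have h2 : ((∑ i, ∑ j, x i * A i j * x j : ℚ) : R) < 0 := by
    have := h
    unfold IsNegWitness at this
    exact_mod_cast this
  exact absurd h1 (not_le.2 h2)

/-- A negative witness refutes `PosDef` as well. [folklore] -/
theorem not_posDef [StarRing R] [TrivialStar R] (h : IsNegWitness A x) :
    ¬ (A.map (Rat.cast : ℚ → R)).PosDef :=
  fun hA => h.not_posSemidef hA.posSemidef

/-- Over `ℚ` itself. [folklore] -/
theorem not_posSemidef_rat (h : IsNegWitness A x) : ¬ A.PosSemidef := by
  simpa using h.not_posSemidef (R := ℚ)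

end IsNegWitness

/-- **Self-refutation of positive semidefiniteness**: the vector found in the kernel by
`negWitness` has negative quadratic form. Decidable; close it by `decide +kernel`. [folklore] -/
def NegCert (A : Matrix (Fin n) (Fin n) ℚ) : Prop :=
  IsNegWitness A (negWitness A)

/-- Decidability of `NegCert`. [folklore] -/
instance NegCert.instDecidable (A : Matrix (Fin n) (Fin n) ℚ) : Decidable (NegCert A) :=
  inferInstanceAs (Decidable (IsNegWitness A (negWitness A)))

namespace NegCert

variable {A : Matrix (Fin n) (Fin n) ℚ}

/-- The underlying witness. [folklore] -/
theorem isNegWitness (h : NegCert A) : IsNegWitness A (negWitness A) := h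

/-- **Soundness**: `¬ (A.map cast).PosSemidef` (e.g. over `ℝ`). [folklore] -/
theorem not_posSemidef [StarRing R] [TrivialStar R] (h : NegCert A) :
    ¬ (A.map (Rat.cast : ℚ → R)).PosSemidef :=
  h.isNegWitness.not_posSemidef

/-- `¬ (A.map cast).PosDef`. [folklore] -/
theorem not_posDef [StarRing R] [TrivialStar R] (h : NegCert A) :
    ¬ (A.map (Rat.cast : ℚ → R)).PosDef :=
  h.isNegWitness.not_posDef

/-- Over `ℚ` itself. [folklore] -/
theorem not_posSemidef_rat (h : NegCert A) : ¬ A.PosSemidef := h.isNegWitness.not_posSemidef_rat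

end NegCert

/-- **Witness of non-definiteness**: a NONZERO rational vector with `xᵀ A x ≤ 0`. Decidable.
[folklore] -/
def IsNonposWitness (A : Matrix (Fin n) (Fin n) ℚ) (x : Fin n → ℚ) : Prop :=
  (∃ i, x i ≠ 0) ∧ ∑ i, ∑ j, x i * A i j * x j ≤ 0

/-- Decidability of `IsNonposWitness`. [folklore] -/
instance IsNonposWitness.instDecidable (A : Matrix (Fin n) (Fin n) ℚ) (x : Fin n → ℚ) :
    Decidable (IsNonposWitness A x) :=
  inferInstanceAs (Decidable ((∃ i, x i ≠ 0) ∧ ∑ i, ∑ j, x i * A i j * x j ≤ 0))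

namespace IsNonposWitness

variable {A : Matrix (Fin n) (Fin n) ℚ} {x : Fin n → ℚ}

/-- **Soundness**: a nonzero nonpositive witness refutes `PosDef` of the cast matrix over any
linearly ordered field with trivial star (e.g. `ℝ`). [folklore] -/
theorem not_posDef [StarRing R] [TrivialStar R] (h : IsNonposWitness A x) :
    ¬ (A.map (Rat.cast : ℚ → R)).PosDef := by
  intro hA
  obtain ⟨⟨i, hi⟩, hle⟩ := h
  have hx : (fun i => (x i : R)) ≠ 0 := by
    intro h0
    have := congr_fun h0 i
    simp only [Pi.zero_apply, Rat.cast_eq_zero] at this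
    exact hi this
  have h1 := hA.dotProduct_mulVec_pos hx
  rw [star_trivial, ← cast_quadForm] at h1
  have h2 : ((∑ i, ∑ j, x i * A i j * x j : ℚ) : R) ≤ 0 := by exact_mod_cast hle
  exact absurd h1 (not_lt.2 h2)

/-- Over `ℚ` itself. [folklore] -/
theorem not_posDef_rat (h : IsNonposWitness A x) : ¬ A.PosDef := by
  simpa using h.not_posDef (R := ℚ)

end IsNonposWitness

/-- **Self-refutation of positive definiteness**: the vector found in the kernel by
`nonposWitness` is nonzero with nonpositive quadratic form. Decidable; `decide +kernel`.
[folklore] -/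
def NonposCert (A : Matrix (Fin n) (Fin n) ℚ) : Prop :=
  IsNonposWitness A (nonposWitness A)

/-- Decidability of `NonposCert`. [folklore] -/
instance NonposCert.instDecidable (A : Matrix (Fin n) (Fin n) ℚ) : Decidable (NonposCert A) :=
  inferInstanceAs (Decidable (IsNonposWitness A (nonposWitness A)))

namespace NonposCert

variable {A : Matrix (Fin n) (Fin n) ℚ}

/-- The underlying witness. [folklore] -/
theorem isNonposWitness (h : NonposCert A) : IsNonposWitness A (nonposWitness A) := h

/-- **Soundness**: `¬ (A.map cast).PosDef` (e.g. over `ℝ`). [folklore] -/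
theorem not_posDef [StarRing R] [TrivialStar R] (h : NonposCert A) :
    ¬ (A.map (Rat.cast : ℚ → R)).PosDef :=
  h.isNonposWitness.not_posDef

/-- Over `ℚ` itself. [folklore] -/
theorem not_posDef_rat (h : NonposCert A) : ¬ A.PosDef := h.isNonposWitness.not_posDef_rat

end NonposCert

/-! ### The non-symmetric case (also decidable) -/

/-- A matrix that is not entrywise symmetric is not positive semidefinite after casting into any
linearly ordered field with trivial star (`PosSemidef` includes `IsHermitian`). [folklore] -/
theorem not_posSemidef_of_not_symm [StarRing R] [TrivialStar R] {A : Matrix (Fin n) (Fin n) ℚ}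
    (h : ¬ ∀ i j, A i j = A j i) : ¬ (A.map (Rat.cast : ℚ → R)).PosSemidef := by
  intro hA
  apply h
  intro i j
  have hH := hA.isHermitian
  have hij := congr_fun (congr_fun hH i) j
  simp only [Matrix.conjTranspose_apply, Matrix.map_apply, star_trivial] at hij
  exact_mod_cast hij.symm

/-- The same for `PosDef`. [folklore] -/
theorem not_posDef_of_not_symm [StarRing R] [TrivialStar R] {A : Matrix (Fin n) (Fin n) ℚ}
    (h : ¬ ∀ i j, A i j = A j i) : ¬ (A.map (Rat.cast : ℚ → R)).PosDef :=
  fun hA => not_posSemidef_of_not_symm h hA.posSemidef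

/-! ### Tests / usage templates (kernel-checked; no certificate data anywhere below) -/

/-- Test: the path-graph matrix `[[2,-1,0],[-1,2,-1],[0,-1,2]]` is PSD over `ℝ`, the `LDLᵀ` being
computed by the kernel. -/
example : ((!![2, -1, 0; -1, 2, -1; 0, -1, 2] : Matrix (Fin 3) (Fin 3) ℚ).map
    (Rat.cast : ℚ → ℝ)).PosSemidef :=
  LDLCert.posSemidef (by decide +kernel)

/-- Test: … and positive DEFINITE, the margin being searched by halving from `1` (found: `1/2`;
`λ_min = 2 − √2 ≈ 0.586`). -/
example : ((!![2, -1, 0; -1, 2, -1; 0, -1, 2] : Matrix (Fin 3) (Fin 3) ℚ).map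
    (Rat.cast : ℚ → ℝ)).PosDef :=
  LDLCertPD.posDef (K := 4) (ε₀ := 1) (by decide +kernel)

/-- Test: the searched margin is a certified bound `λ_min ≥ 1/2`, usable as a number. -/
example : pdMargin (!![2, -1, 0; -1, 2, -1; 0, -1, 2] : Matrix (Fin 3) (Fin 3) ℚ) 4 1 = 1 / 2 := by
  decide +kernel

/-- Test: a SINGULAR PSD matrix (zero pivots are skipped): the all-ones `3 × 3` matrix, in the
quadratic-form shape. -/
example (x : Fin 3 → ℝ) :
    0 ≤ ∑ i, ∑ j, x i * x j * (((!![1, 1, 1; 1, 1, 1; 1, 1, 1] : Matrix (Fin 3) (Fin 3) ℚ) i j : ℚ) : ℝ) :=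
  LDLCert.quadForm_nonneg' (by decide +kernel) x

/-- Test: … which is NOT positive definite (the kernel finds `x = (-1, 1, 0)` with `xᵀAx = 0`). -/
example : ¬ ((!![1, 1, 1; 1, 1, 1; 1, 1, 1] : Matrix (Fin 3) (Fin 3) ℚ).map
    (Rat.cast : ℚ → ℝ)).PosDef :=
  NonposCert.not_posDef (by decide +kernel)

/-- Test: `[[1, 2], [2, 1]]` is NOT positive semidefinite (negative pivot after one step; the kernel
finds `x = (-2, 1)`, `xᵀAx = -3`). -/
example : ¬ ((!![1, 2; 2, 1] : Matrix (Fin 2) (Fin 2) ℚ).map (Rat.cast : ℚ → ℝ)).PosSemidef :=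
  NegCert.not_posSemidef (by decide +kernel)

/-- Test: `[[0, 1], [1, 0]]` is NOT positive semidefinite (zero pivot with a nonzero off-diagonal
entry; the kernel finds `x = (-1/2, 1)`, `xᵀAx = -1`). -/
example : ¬ ((!![0, 1; 1, 0] : Matrix (Fin 2) (Fin 2) ℚ).map (Rat.cast : ℚ → ℝ)).PosSemidef :=
  NegCert.not_posSemidef (by decide +kernel)

/-- Test: a non-symmetric matrix is not PSD, by `decide` on the symmetry test. -/
example : ¬ ((!![1, 2; 0, 1] : Matrix (Fin 2) (Fin 2) ℚ).map (Rat.cast : ℚ → ℝ)).PosSemidef :=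
  not_posSemidef_of_not_symm (by decide +kernel)

/-- Test (a matrix given by a FORMULA, and an ill-conditioned one): the `8 × 8` Hilbert matrix
`H i j = 1 / (i + j + 1)` is positive definite over `ℝ`; `λ_min ≈ 1.11 · 10⁻¹⁰`, and the halving
search from `1` certifies the margin `2⁻³⁴ ≈ 5.8 · 10⁻¹¹` at the 35th attempt. -/
example : ((Matrix.of fun i j : Fin 8 => (1 : ℚ) / ((i : ℚ) + (j : ℚ) + 1)).map
    (Rat.cast : ℚ → ℝ)).PosDef :=
  LDLCertPD.posDef (K := 40) (ε₀ := 1) (by decide +kernel)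

/-- Test: the margin found for the Hilbert matrix is `2⁻³⁴`. -/
example : pdMargin (Matrix.of fun i j : Fin 8 => (1 : ℚ) / ((i : ℚ) + (j : ℚ) + 1)) 40 1 =
    1 / 2 ^ 34 := by
  decide +kernel

/-- Test: … while `H − 2⁻³³ · 1` is NOT positive semidefinite (so `2⁻³⁴ ≤ λ_min < 2⁻³³` is
certified from both sides, entirely in the kernel). -/
example : ¬ (((Matrix.of fun i j : Fin 8 => (1 : ℚ) / ((i : ℚ) + (j : ℚ) + 1)) -
      (1 / 2 ^ 33 : ℚ) • (1 : Matrix (Fin 8) (Fin 8) ℚ)).map (Rat.cast : ℚ → ℝ)).PosSemidef :=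
  NegCert.not_posSemidef (by decide +kernel)

end PSD

end Literature.Computation.Certificates
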